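import Mathlib
import Summits.ValiantsHypothesis.ValiantsHypothesis.Theorems.BarrierLeverPartitionMinorsHitByVPHiddenStatesSecondShellCrossTemplate
import Summits.ValiantsHypothesis.ValiantsHypothesis.Theorems.BarrierLeverPartitionMinorsHitByVPHiddenStatesSecondShellReduced
import Summits.ValiantsHypothesis.ValiantsHypothesis.Theorems.BarrierLeverPartitionMinorsHitByVPHiddenStatesSecondShellTwoTops

/-!
# Route BarrierLever — item `PartitionMinorsHitByVP` (stmt-ValiantsHypothesis-19717), line `hidden-states`:
# ★★ THE MASTER CELL TEMPLATE — «two transports, an acyclic union digraph, no reduced configuration ⇒ served»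

Helper file (`--supports stmt-ValiantsHypothesis-19717`; cell valiant-natproofs, 𝒟-side door (c), registered line
`Cruxes/PartitionMinorsHitByVP/Lines/hidden_states.lean` v9; prover seat val-np-p6 gen 19).  Closes NO item; definition-free.

THE TEMPLATE (memo HOME/val-np-p6/g19/MEMO-valnp6-g19.md §4b).  `…SecondShellCrossTemplate.exists_table_secondShell_of_cross` serves a
second-shell family as soon as one cross minor of the two-parameter table `I + ε₀N₁ + ε₁N₂` (`N_l = swapTable' e_l − I`) vanishes for
every parameter; `…SecondShellReduced.det_eq_zero_of_no_reduced` makes a cross minor of an ACYCLIC table vanish as soon as every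
configuration along its edges has an active token.  The edges of the two-parameter table lie in the UNION DIGRAPH
`G = {u → v : swapTable' e₁ u v ≠ 0 ∨ swapTable' e₂ u v ≠ 0, u ≠ v}` for every parameter, so a TABLE-FREE hypothesis suffices:
★★ `exists_table_secondShell_of_noReduced` — transports `e₁, e₂`, a potential making `G` acyclic, and «no reduced configuration in `G`»
for `D(A₁ ← C₂)` or for `D(A₂ ← C₁)` ⇒ the family is served.  Every chain cell of gen 17/18 is an instance; the censuses of this seat
(kit j324943, j325089/91/95/97: t ≤ 7, 0 uncertified) say that together with the immobile-token cell and the cyclic equal-Y-3 cell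
this template covers every second-shell family met so far.

HONEST LABEL: conjecture-column toolkit (second shell, every `t, h`); 19717 stays OPEN; nothing on crux 14610 or VP ≠ VNP.
-/

set_option linter.dupNamespace false

namespace Summit.ValiantsHypothesis.ValiantsHypothesis.Theorems.BarrierLever.HiddenStates

open Finset

noncomputable section

namespace SecondShell

open PathTable

/-- the two-parameter table has unit diagonal and its edges lie in the union digraph of the two transports. -/
theorem tab2_swapTable'_edges {h : ℕ} {k₁ j₁ j₁' k₂ j₂ j₂' : ℕ}
    (e₁ : (Fin (k₁ + 1) ⊕ Fin k₁) ⊕ (Fin j₁ ⊕ Fin j₁') ≃ Fin h)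
    (e₂ : (Fin (k₂ + 1) ⊕ Fin k₂) ⊕ (Fin j₂ ⊕ Fin j₂') ≃ Fin h) (ε : Fin 2 → ℂ) :
    (∀ u, tab2 (fun a q => swapTable' e₁ a q - if q = a then 1 else 0)
        (fun a q => swapTable' e₂ a q - if q = a then 1 else 0) ε u u = 1) ∧
    (∀ u v, u ≠ v → tab2 (fun a q => swapTable' e₁ a q - if q = a then 1 else 0)
        (fun a q => swapTable' e₂ a q - if q = a then 1 else 0) ε u v ≠ 0 →
        swapTable' e₁ u v ≠ 0 ∨ swapTable' e₂ u v ≠ 0) := by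
  constructor
  · intro u
    simp only [tab2, swapTable'_self, if_true]
    ring
  · intro u v huv hw
    by_contra hcon
    push Not at hcon
    apply hw
    simp only [tab2, hcon.1, hcon.2, if_neg (Ne.symm huv)]
    ring

/-- ★★ **THE MASTER CELL TEMPLATE.**  Transports `e₁` (swap `A₁ → C₁`) and `e₂` (swap `A₂ → C₂`), a potential for which every edge
of the union digraph goes down, and NO REDUCED CONFIGURATION in the union digraph for the cross minor `D(A₁ ← C₂)` (first disjunct) or
`D(A₂ ← C₁)` (second disjunct) ⇒ the second-shell family `B_t(h) ∖ {A₁, A₂} ∪ {C₁, C₂}` is served by a two-parameter path table. -/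
theorem exists_table_secondShell_of_noReduced (h t : ℕ) (A₁ A₂ C₁ C₂ : Finset (Fin h))
    (hA₁ : A₁.card = t) (hA₂ : A₂.card = t) (hC₁ : C₁.card = t + 1) (hC₂ : C₂.card = t + 1)
    (hA : A₁ ≠ A₂) (hC : C₁ ≠ C₂)
    {k₁ j₁ j₁' k₂ j₂ j₂' : ℕ} (hk₁ : 1 ≤ k₁) (hkj₁ : k₁ + j₁ = t) (hk₂ : 1 ≤ k₂) (hkj₂ : k₂ + j₂ = t)
    (e₁ : (Fin (k₁ + 1) ⊕ Fin k₁) ⊕ (Fin j₁ ⊕ Fin j₁') ≃ Fin h)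
    (m1 : ∀ x, e₁ (Sum.inl (Sum.inl x)) ∈ C₁ \ A₁) (m2 : ∀ i, e₁ (Sum.inl (Sum.inr i)) ∈ A₁ \ C₁)
    (m3 : ∀ z, e₁ (Sum.inr (Sum.inl z)) ∈ A₁ ∩ C₁) (m4 : ∀ x, e₁ (Sum.inr (Sum.inr x)) ∈ (A₁ ∪ C₁)ᶜ)
    (e₂ : (Fin (k₂ + 1) ⊕ Fin k₂) ⊕ (Fin j₂ ⊕ Fin j₂') ≃ Fin h)
    (n1 : ∀ x, e₂ (Sum.inl (Sum.inl x)) ∈ C₂ \ A₂) (n2 : ∀ i, e₂ (Sum.inl (Sum.inr i)) ∈ A₂ \ C₂)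
    (n3 : ∀ z, e₂ (Sum.inr (Sum.inl z)) ∈ A₂ ∩ C₂) (n4 : ∀ x, e₂ (Sum.inr (Sum.inr x)) ∈ (A₂ ∪ C₂)ᶜ)
    (pot : Fin h → ℕ) (hdag : ∀ u v, u ≠ v → (swapTable' e₁ u v ≠ 0 ∨ swapTable' e₂ u v ≠ 0) → pot v < pot u)
    (hnone : (∀ f g : Fin h → Fin h, (∀ u, u ∉ C₂ → f u = u) →
        (∀ u ∈ C₂, f u ≠ u → swapTable' e₁ u (f u) ≠ 0 ∨ swapTable' e₂ u (f u) ≠ 0) →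
        (∀ u, g u ≠ u → swapTable' e₁ u (g u) ≠ 0 ∨ swapTable' e₂ u (g u) ≠ 0) →
        (C₂.image f).card = t → Disjoint (mov g) A₁ → C₂.image f ⊆ A₁ ∪ mov g →
        (mov g).image g = (A₁ ∪ mov g) \ C₂.image f →
        ∃ u ∈ C₂, u ∉ A₁ ∧ f u ∉ (C₂.erase u).image f ∧ (f u = u ↔ g u ≠ u)) ∨
      (∀ f g : Fin h → Fin h, (∀ u, u ∉ C₁ → f u = u) →
        (∀ u ∈ C₁, f u ≠ u → swapTable' e₁ u (f u) ≠ 0 ∨ swapTable' e₂ u (f u) ≠ 0) →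
        (∀ u, g u ≠ u → swapTable' e₁ u (g u) ≠ 0 ∨ swapTable' e₂ u (g u) ≠ 0) →
        (C₁.image f).card = t → Disjoint (mov g) A₂ → C₁.image f ⊆ A₂ ∪ mov g →
        (mov g).image g = (A₂ ∪ mov g) \ C₁.image f →
        ∃ u ∈ C₁, u ∉ A₂ ∧ f u ∉ (C₁.erase u).image f ∧ (f u = u ↔ g u ≠ u)))
    {r : ℕ} (u cols : Fin r → Finset (Fin h)) (hu : Function.Injective u)
    (hU : ∀ i, ((u i).card ≤ t ∧ u i ≠ A₁ ∧ u i ≠ A₂) ∨ u i = C₁ ∨ u i = C₂)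
    (hcols : ∀ J : Finset (Fin h), J.card ≤ t → ∃ kk, cols kk = J) :
    ∃ tx : Option (Fin h) → Fin h → ℂ,
      (Matrix.of fun i kk : Fin r => ∏ a ∈ u i, (tx none a + ∑ q ∈ cols kk, tx (some q) a)).det ≠ 0 := by
  classical
  refine exists_table_secondShell_of_cross h t A₁ A₂ C₁ C₂ hA₁ hA₂ hC₁ hC₂ hA hC hk₁ hkj₁ hk₂ hkj₂ e₁ m1 m2 m3 m4
    e₂ n1 n2 n3 n4 u cols hu hU hcols ?_
  rcases hnone with hnone | hnone
  · left
    intro rows i₀ hrow₀ key hcolcard ε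
    obtain ⟨hdiag, hedge⟩ := tab2_swapTable'_edges e₁ e₂ ε
    set w := tab2 (fun a q => swapTable' e₁ a q - if q = a then 1 else 0)
      (fun a q => swapTable' e₂ a q - if q = a then 1 else 0) ε with hw
    refine det_eq_zero_of_no_reduced w hdiag pot (fun a b hab hwab => hdag a b hab (hedge a b hab hwab)) t rows cols i₀
      C₂ A₁ hrow₀ hC₂ hA₁ key hcolcard fun f g h0 h1 h2 h3 h4 h5 h6 => hnone f g h0
        (fun a ha hfa => hedge a (f a) (Ne.symm hfa) (h1 a ha hfa)) (fun a hga => hedge a (g a) (Ne.symm hga) (h2 a hga)) h3 h4 h5 h6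
  · right
    intro rows i₀ hrow₀ key hcolcard ε
    obtain ⟨hdiag, hedge⟩ := tab2_swapTable'_edges e₁ e₂ ε
    set w := tab2 (fun a q => swapTable' e₁ a q - if q = a then 1 else 0)
      (fun a q => swapTable' e₂ a q - if q = a then 1 else 0) ε with hw
    refine det_eq_zero_of_no_reduced w hdiag pot (fun a b hab hwab => hdag a b hab (hedge a b hab hwab)) t rows cols i₀
      C₁ A₂ hrow₀ hC₁ hA₂ key hcolcard fun f g h0 h1 h2 h3 h4 h5 h6 => hnone f g h0
        (fun a ha hfa => hedge a (f a) (Ne.symm hfa) (h1 a ha hfa)) (fun a hga => hedge a (g a) (Ne.symm hga) (h2 a hga)) h3 h4 h5 h6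

end SecondShell

end

end Summit.ValiantsHypothesis.ValiantsHypothesis.Theorems.BarrierLever.HiddenStates
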